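import Literature.AlgebraicGeometry.AbelianSchemes.AbelianSchemeLiftOfClassZeroQuot
import Literature.AlgebraicGeometry.AbelianSchemes.AbelianSchemeLiftOfClassZeroInduction
import Literature.AlgebraicGeometry.AbelianSchemes.AbelianSchemeBaseChangeViaIso
import Literature.AlgebraicGeometry.AbelianSchemes.AbelianLiftObstructionClass
import Literature.AlgebraicGeometry.AbelianSchemes.AbelianSchemeOverGlueData
import Literature.AlgebraicGeometry.AbelianSchemes.AbelianSchemeRelDimOfGenericFibre
import Literature.RingTheory.Artinian.SmallExtensionFlag
import HarnessLib

/-!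
# An abelian scheme over `A⧸J₀` lifts to the Artin local ring `A` when the lift obstruction vanishes at every principal small rung
# ([Oort1971] §2.2, first proof of Thm. (2.2.1); [MumfordFogartyKirwan1994] Ch. 6 §3 Prop. 6.15)

Layer `Literature/AlgebraicGeometry/AbelianSchemes`, namespace `Literature.AlgebraicGeometry.AbelianSchemes.AbelianSchemeOver`.
PROOF FILE, THEOREMS ONLY (no definition, no instance, no notation, no named fact, no `sorry`).  FINAL-CONSUMER head **FC-4 (the ASSEMBLER)**
of the (U) road (cell `hodgecm-mathlib`, P6 sub-desk P6b, desk deal 2026-09-02T20:08:22Z; count-neutral ★ capital on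
`--supports stmt-HodgeConjecture-24832`).  It composes, and proves nothing new:

* ★ FC-3 `exists_abelianLift_of_rungs` (LA3-p02): the scheme-side descent along the principal small rungs `A⧸J′ → A⧸J` below `J₀`
  (driver ★ `Literature.RingTheory.Artinian.descent_on_principalSmall`, B-p04), with the one-step lifts as an ABSTRACT binder `hstep`;
* ★ FC-2 §2 `exists_abelianLift_of_classZero` (A-p12): the one-step lift along a principal small extension `A′ → A′⧸L` under the named
  hypothesis ★ `LiftObstructionVanishes` (A-p12, (D)) — applied at `A′ := A⧸J′`, `L := J∕J′` in the rung currency of ★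
  `Literature.RingTheory.Artinian.principalSmallLine_map_mk` (`A⧸J′` local, `J∕J′` proper, killed by `𝔪`, a κ-line `φ`);
* the TRANSPORT of the abelian scheme `Y₀` over `A⧸J` to the isomorphic base `Spec ((A⧸J′)⧸(J∕J′))` and back (★ (s3)
  `isBaseChangeVia_baseChange_inv`, LA2-p03; Mathlib `DoubleQuot.quotQuotEquivQuotOfLE`; ★ `IsBaseChangeVia.trans` ∕ `congr_base`;
  ★ `IsOfRelDim.of_isBaseChangeVia`), the ring identity being `quotQuotEquivQuotOfLE ∘ mk (J∕J′) = factor : A⧸J′ → A⧸J`.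

THE PRINT.  [Oort1971, p. 279]: «Let `R → R′` be a surjection of local artinian rings with kernel `I`; by induction on the length of `I` we may
assume `𝔪_R · I = 0` and `I ≅ k` …»; [MumfordFogartyKirwan1994, Prop. 6.15, proof p. 125]: «by induction we may assume `𝔪·I = (0)`».

THE STATEMENT `exists_abelianLift_of_liftObstructionVanishes`: `A` Artinian local (universe `Type`, as FC-2), `J₀ ≠ ⊤`; HYPOTHESIS `hvan`: at
every principal small rung `J′ < J ≤ J₀` (`𝔪J ≤ J′`, `t ∈ J ∖ J′`, `J′ ⊔ (t) = J`), for the induced structure (`A⧸J′` local, `L := J.map (mk J′)`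
proper with `𝔪·L = 0` and a κ-line `φ`), the lift obstruction of EVERY abelian scheme of relative dimension `g` over `Spec ((A⧸J′)⧸L)` vanishes
(★ `LiftObstructionVanishes` — the (U-ab) input, NOT proved on this road); CONCLUSION: every abelian scheme `X₀` of relative dimension `g` over
`Spec (A⧸J₀)` is the base change, as a group scheme (★ `IsBaseChangeVia`), of an abelian scheme `X` of relative dimension `g` over `Spec A` along
`Spec (A → A⧸J₀)` — the conclusion of the banked `Cruxes/HLiu418/Lines/F0_P6b_BTSerreTate.stub_L4B1u_abelianLiftOfIsUnitTwo` token for token.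

HC_CM is proved only modulo the printed citations until rung 0 closes; nothing here bears on a summit statement.

## References
* [Oort1971] F. Oort, *Finite group schemes, local moduli for abelian varieties, and lifting problems*, Compositio Math. 23 (1971),
  Theorem (2.2.1) (p. 273) and its first proof (pp. 279–280).
* [MumfordFogartyKirwan1994] D. Mumford, J. Fogarty, F. Kirwan, *Geometric Invariant Theory*, 3rd ed. (1994), Ch. 6 §3 Prop. 6.15
  (p. 124) and its proof (p. 125); Ch. 7 §2 Def. 7.2 (p. 129).
* [StacksProject] The Stacks Project, Tag 06GE (Lemma 90.3.3: factoring a surjection of Artin local rings into small extensions).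
-/

noncomputable section

set_option backward.isDefEq.respectTransparency false

open CategoryTheory CategoryTheory.Limits AlgebraicGeometry IsLocalRing

namespace Literature.AlgebraicGeometry.AbelianSchemes.AbelianSchemeOver

open Literature.RingTheory.Artinian

/-- **FC-4 — LIFTING ALONG `A → A⧸J₀` FROM THE VANISHING OF THE LIFT OBSTRUCTION AT EVERY PRINCIPAL SMALL RUNG.**  `A` Artinian local,
`J₀ ≠ ⊤`.  If for every principal small rung `J′ < J ≤ J₀` (`𝔪J ≤ J′`, `t ∈ J ∖ J′`, `J′ ⊔ (t) = J`) and every abelian scheme `Y₀` of relative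
dimension `g` over `Spec ((A⧸J′)⧸(J∕J′))` the lift obstruction vanishes (★ `LiftObstructionVanishes` for the local ring `A⧸J′`, the proper ideal
`J∕J′` killed by `𝔪`, and a κ-line structure `φ` on it), then every abelian scheme `X₀` of relative dimension `g` over `Spec (A⧸J₀)` is the base
change, as a group scheme, of an abelian scheme `X` of relative dimension `g` over `Spec A` along `Spec (A → A⧸J₀)`.  Proof: ★ FC-3's descent
with `hstep` := transport along `(A⧸J′)⧸(J∕J′) ≅ A⧸J` + ★ FC-2's one-step lift + transport back.
[cite: Oort1971, Theorem (2.2.1) (p. 273), first proof (pp. 279–280)] [cite: MumfordFogartyKirwan1994, Ch. 6 §3 Proposition 6.15 (p. 124), proof (p. 125)]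
[cite: StacksProject, Tag 06GE] -/
theorem exists_abelianLift_of_liftObstructionVanishes {A : Type} [CommRing A] [IsArtinianRing A] [IsLocalRing A]
    (J₀ : Ideal A) (hJ₀ : J₀ ≠ ⊤) {g : ℕ}
    (hvan : ∀ ⦃J J' : Ideal A⦄ (t : A), J ≤ J₀ → J' < J → maximalIdeal A * J ≤ J' → t ∈ J → t ∉ J' →
      J' ⊔ Ideal.span {t} = J →
      ∀ (hI : IsLocalRing (A ⧸ J')) (hL : J.map (Ideal.Quotient.mk J') ≠ ⊤)
        (hmL : maximalIdeal (A ⧸ J') * J.map (Ideal.Quotient.mk J') = ⊥)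
        (φ : ↥(J.map (Ideal.Quotient.mk J')) ≃ₗ[A ⧸ J'] ResidueField (A ⧸ J'))
        (Y₀ : AbelianSchemeOver (Spec (.of ((A ⧸ J') ⧸ J.map (Ideal.Quotient.mk J'))))),
        Y₀.IsOfRelDim g → LiftObstructionVanishes hL hmL φ Y₀)
    (X₀ : AbelianSchemeOver (Spec (.of (A ⧸ J₀)))) (hg : X₀.IsOfRelDim g) :
    ∃ (X : AbelianSchemeOver (Spec (.of A))) (_ : X.IsOfRelDim g) (G : X₀.X.left ⟶ X.X.left),
      X₀.IsBaseChangeVia X (Spec.map (CommRingCat.ofHom (Ideal.Quotient.mk J₀))) G := by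
  refine exists_abelianLift_of_rungs J₀ (fun J J' t hJJ₀ hJ'J hmJ htJ htJ' hsup Y₀ hY₀ => ?_) X₀ hg
  -- the rung `A⧸J' → A⧸J` in the letters of FC-2 (★ `principalSmallLine_map_mk`)
  have hJtop : J ≠ ⊤ := fun h => hJ₀ (top_le_iff.mp (h ▸ hJJ₀))
  obtain ⟨hI, hL, hmL, ⟨φ⟩⟩ := principalSmallLine_map_mk hJtop hJ'J hmJ htJ' hsup
  -- transport `Y₀` along `Spec ((A⧸J')⧸(J∕J')) ≅ Spec (A⧸J)` (Mathlib `DoubleQuot.quotQuotEquivQuotOfLE`)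
  let e : (A ⧸ J') ⧸ J.map (Ideal.Quotient.mk J') ≃+* A ⧸ J := DoubleQuot.quotQuotEquivQuotOfLE hJ'J.le
  let es : Spec (.of ((A ⧸ J') ⧸ J.map (Ideal.Quotient.mk J'))) ≅ Spec (.of (A ⧸ J)) :=
    Scheme.Spec.mapIso e.symm.toCommRingCatIso.op
  have hY₀' : (Y₀.baseChange es.hom).IsOfRelDim g :=
    IsOfRelDim.of_isBaseChangeVia (Y₀.baseChange_isBaseChangeVia es.hom) hY₀
  -- ★ FC-2: the one-step lift of the transported scheme, under the vanishing hypothesis at this rung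
  obtain ⟨Y, hY, G, hbc⟩ := exists_abelianLift_of_classZero hL hmL φ (Y₀.baseChange es.hom) hY₀'
    (hvan t hJJ₀ hJ'J hmJ htJ htJ' hsup hI hL hmL φ _ hY₀')
  -- transport back (★ (s3)) and read the base map as `Spec (factor : A⧸J' → A⧸J)`
  have hbase : es.inv ≫ Spec.map (CommRingCat.ofHom (Ideal.Quotient.mk (J.map (Ideal.Quotient.mk J')))) =
      Spec.map (CommRingCat.ofHom (Ideal.Quotient.factor hJ'J.le)) := by
    change Spec.map (CommRingCat.ofHom (e.symm.symm : (A ⧸ J') ⧸ J.map (Ideal.Quotient.mk J') →+* A ⧸ J)) ≫ _ = _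
    rw [← Spec.map_comp, ← CommRingCat.ofHom_comp]
    congr 2
    exact Ideal.Quotient.ringHom_ext (RingHom.ext fun x => rfl)
  exact ⟨Y, hY, _, IsBaseChangeVia.congr_base hbase ((isBaseChangeVia_baseChange_inv Y₀ es).trans hbc)⟩

end Literature.AlgebraicGeometry.AbelianSchemes.AbelianSchemeOver

end
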